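import Summits.CriticalPhenomena.PercolationContinuityZ3.Theorems.PercNearOneGluingNoHeavyLowerTailSunflowerGraphMarkWindowStep
import HarnessLib

/-!
# `NoHeavyLowerTail` (crux stmt-CriticalPhenomena-4575), abstract sunflower cubic: ★ = `PartitionLemmaH` FOR EVERY PROPERLY 3-EDGE-COLOURED
# GRAPH OF MAXIMUM DEGREE ≤ 2 WITH ARBITRARY COLOUR MARKS — the structured-window induction assembled

Support file (seat `prim-ineq-gen-2` gen 26; `--supports stmt-CriticalPhenomena-4575`).  No `sorry`; nothing is asserted about the crux.
Memo: run/shared/lean/prim/prim-ineq-gen-2/TWO-POINT-GEN25.md §8–§9 (certificates, blueprint), GRAPHMARK-LEAN-GEN26.md (this assembly).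

THEOREM (`Sunflower.ZH_nonneg_of_isGraphMarkOn_maxDegTwo`, `ZH_graphMarkSunflower_nonneg_of_maxDegTwo`).  Let `c` be a PROPER 3-edge-colouring
of a graph on the finite set `α` (`IsProperEdgeColouring`: symmetric, loopless, no two edges of the same colour at a vertex) of maximum degree
`≤ 2` (`MaxDegLE c 2`: disjoint unions of paths and cycles), and `T : α → Finset (Fin 3)` arbitrary colour marks.  Then every sunflower whose
labels are `lab U = θ(colours of the edges inside U ∪ marks inside U)` satisfies `0 ≤ ZH` — the partition lemma ★ on the first infinite rank-2
family that is neither a composition nor covered by any one- or two-point product-class certificate (memo §3b, §6–§8).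

PROOF = strong induction on `#W` over all sub-cubes, colourings, marks and graph-mark sunflowers at once (`ZP_nonneg_of_isGraphMarkOn`), with the
case analysis of the memo §8: a MARKED point is a good coordinate (tree Theorem A `ZP_le_ZP_insert_of_lab_singleton_ne_zero`); an unmarked point
with at most one neighbour is PENDANT/ISOLATED (`ZP_insert_ge_of_pendant`); otherwise the point `q` has two neighbours `p, r` joined to it by
edges of distinct colours, renamed `0, 1` by a recolouring (`exists_recolouring`, `IsGraphMarkOn.ZP_eq_of_recolour`, `graphMarkSunflower`);
if `p` or `r` is pendant we are done, if `p ∼ r` the triangle is rainbow and `two_ZP_insert_insert_ge_of_triangleEdge` applies, else the window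
`u–p–q–r–w` has one of the seven colour/coincidence patterns of the landed certificates `c4a/c4b/c4c/pth21/pth23/pth31/pth33_window`, whose
hypotheses follow from the local label calculus (`IsGraphMarkOn.lab_insert`, `nb_eq_ite`) and whose minors are graph-mark on smaller
sub-cubes (`IsGraphMarkOn.mono/.con`), hence nonnegative by induction.
-/

namespace Summit.CriticalPhenomena.PercolationContinuityZ3.Theorems.SunflowerPartition

open Finset

variable {α : Type*} [Fintype α] [DecidableEq α]

namespace Sunflower

variable {F : Sunflower α} {c : α → α → Option (Fin 3)} {T : α → Finset (Fin 3)} {W : Finset α}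

section Steps

variable (hc : IsProperEdgeColouring c) (hF : F.IsGraphMarkOn c T W)
  (hIH : ∀ (F' : Sunflower α) (T' : α → Finset (Fin 3)) (W' : Finset α), #W' < #W → F'.IsGraphMarkOn c T' W' → 0 ≤ F'.ZP W' ∅ ∅ ∅)
include hc hF hIH

/-- An unmarked point `q` whose neighbours in `W` are `p` (colour `0`) and `r` (colour `1`): pendant neighbour, rainbow triangle or window.
[this work] -/
theorem degTwo_step (hdeg : MaxDegLE c 2) (hT : ∀ x ∈ W, T x = ∅) {q p r : α} (hq : q ∈ W) (hp : p ∈ W) (hr : r ∈ W)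
    (h0 : c q p = some 0) (h1 : c q r = some 1) (hNq : ∀ y ∈ W, y ≠ p → y ≠ r → c q y = none) :
    0 ≤ F.ZP W ∅ ∅ ∅ := by
  have hqp : q ≠ p := hc.ne_of_some h0
  have hqr : q ≠ r := hc.ne_of_some h1
  have hpq' : c p q = some 0 := by rw [hc.symm]; exact h0
  have hrq' : c r q = some 1 := by rw [hc.symm]; exact h1
  have hpr : p ≠ r := by
    intro h
    rw [h, h1] at h0
    exact absurd (Option.some_injective _ h0) (by decide)
  -- is `p` pendant?
  by_cases hPp : ∀ y ∈ W, y ≠ q → c p y = none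
  · exact pendant_step hc hF hIH hp (hT p hp) q hPp
  push Not at hPp
  obtain ⟨u, huW, huq, hcu⟩ := hPp
  obtain ⟨cu, hu⟩ := Option.ne_none_iff_exists'.1 hcu
  have hNp : ∀ y ∈ W, y ≠ q → y ≠ u → c p y = none := fun y _ hyq hyu =>
    hdeg.eq_none_of_two huq.symm (by rw [hpq']; rfl) (by rw [hu]; rfl) hyq hyu
  -- is `r` pendant?
  by_cases hPr : ∀ y ∈ W, y ≠ q → c r y = none
  · exact pendant_step hc hF hIH hr (hT r hr) q hPr
  push Not at hPr
  obtain ⟨w, hwW, hwq, hcw⟩ := hPr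
  obtain ⟨cw, hw⟩ := Option.ne_none_iff_exists'.1 hcw
  have hNr : ∀ y ∈ W, y ≠ q → y ≠ w → c r y = none := fun y _ hyq hyw =>
    hdeg.eq_none_of_two hwq.symm (by rw [hrq']; rfl) (by rw [hw]; rfl) hyq hyw
  by_cases hur : u = r
  · -- rainbow triangle `q p r`
    have hprc : c p r = some cu := by rw [← hur]; exact hu
    have hcu0 : cu ≠ 0 := fun h => huq (hc.proper p u q 0 (by rw [hu, h]) hpq')
    have hcu1 : cu ≠ 1 := fun h => hqp (hc.proper r q p 1 hrq' (by rw [hc.symm, hprc, h]))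
    have key : ∀ x : Fin 3, x ≠ 0 → x ≠ 1 → x = 2 := by decide
    have h2 : c p r = some 2 := by rw [hprc, key cu hcu0 hcu1]
    exact triangle_step hc hF hIH hq hp (hT q hq) (hT p hp) h0 h1 h2 hNq
      (fun y hy hyq hyr => hNp y hy hyq (fun h => hyr (h.trans hur)))
  · -- window `u – p – q – r – w`
    have hcpr : c p r = none := hNp r hr hqr.symm (fun h => hur h.symm)
    exact window_step hc hF hIH hp hq hr huW hwW (hT p hp) (hT q hq) (hT r hr) hpq' h1 hu hw hcpr huq hwq hNp hNq hNr

end Steps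

/-! ## The induction and the theorem -/

/-- **★ on every sub-cube for graph-mark sunflowers of proper colourings of maximum degree `≤ 2`** (strong induction on `#W`, uniformly in the
colouring, the marks and the sunflower). [this work] -/
theorem ZP_nonneg_of_isGraphMarkOn : ∀ (n : ℕ) {c : α → α → Option (Fin 3)}, IsProperEdgeColouring c → MaxDegLE c 2 →
    ∀ (F : Sunflower α) (T : α → Finset (Fin 3)) (W : Finset α), #W = n → F.IsGraphMarkOn c T W → 0 ≤ F.ZP W ∅ ∅ ∅ := by
  intro n
  induction n using Nat.strong_induction_on with
  | _ n ih =>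
  intro c hc hdeg F T W hWn hF
  have hIH : ∀ (F' : Sunflower α) (T' : α → Finset (Fin 3)) (W' : Finset α), #W' < #W → F'.IsGraphMarkOn c T' W' →
      0 ≤ F'.ZP W' ∅ ∅ ∅ := fun F' T' W' hlt hF' => ih #W' (hWn ▸ hlt) hc hdeg F' T' W' rfl hF'
  rcases W.eq_empty_or_nonempty with hE | hne
  · rw [hE, F.ZP_empty]
  by_cases hmark : ∃ v ∈ W, T v ≠ ∅
  · obtain ⟨v, hv, hTv⟩ := hmark
    exact marked_step hc hF hIH hv hTv
  push Not at hmark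
  obtain ⟨v, hv⟩ := hne
  by_cases hlow : ∃ u, ∀ y ∈ W, y ≠ u → c v y = none
  · obtain ⟨u, hu⟩ := hlow
    exact pendant_step hc hF hIH hv (hmark v hv) u hu
  -- `v` has two distinct neighbours `p, r` in `W`
  push Not at hlow
  obtain ⟨p, hpW, -, hcp⟩ := hlow v
  obtain ⟨r, hrW, hrp, hcr⟩ := hlow p
  obtain ⟨a, ha⟩ := Option.ne_none_iff_exists'.1 hcp
  obtain ⟨b, hb⟩ := Option.ne_none_iff_exists'.1 hcr
  have hab : a ≠ b := by
    intro h
    rw [h] at ha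
    exact hrp (hc.proper v r p b hb ha)
  have hNv : ∀ y ∈ W, y ≠ p → y ≠ r → c v y = none := fun y _ hyp hyr =>
    hdeg.eq_none_of_two (Ne.symm hrp) (by rw [ha]; rfl) (by rw [hb]; rfl) hyp hyr
  -- recolour so that `v p` has colour `0` and `v r` colour `1`
  obtain ⟨g, hg, hga, hgb⟩ := exists_recolouring a b hab
  have hc' := hc.recolour hg
  have hdeg' := hdeg.recolour g
  have hG := graphMarkSunflower_isGraphMarkOn (fun x y => (c x y).map g) (fun x => (T x).image g) W
  rw [hF.ZP_eq_of_recolour hg hG]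
  have hIH' : ∀ (F' : Sunflower α) (T' : α → Finset (Fin 3)) (W' : Finset α), #W' < #W →
      F'.IsGraphMarkOn (fun x y => (c x y).map g) T' W' → 0 ≤ F'.ZP W' ∅ ∅ ∅ :=
    fun F' T' W' hlt hF' => ih #W' (hWn ▸ hlt) hc' hdeg' F' T' W' rfl hF'
  have hT' : ∀ x ∈ W, (fun x => (T x).image g) x = ∅ := fun x hx => by simp only [hmark x hx, image_empty]
  refine degTwo_step hc' hG hIH' hdeg' hT' hv hpW hrW ?_ ?_ ?_
  · show (c v p).map g = some 0
    rw [ha, Option.map_some, hga]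
  · show (c v r).map g = some 1
    rw [hb, Option.map_some, hgb]
  · intro y hy hyp hyr
    show (c v y).map g = none
    rw [hNv y hy hyp hyr, Option.map_none]

/-- **THEOREM: ★ = `PartitionLemmaH` for every graph-mark sunflower of a PROPER 3-edge-colouring of maximum degree `≤ 2` with arbitrary
colour marks.** [this work] -/
theorem ZH_nonneg_of_isGraphMarkOn_maxDegTwo (hc : IsProperEdgeColouring c) (hdeg : MaxDegLE c 2)
    (hF : F.IsGraphMarkOn c T univ) : 0 ≤ F.ZH := by
  rw [← F.ZP_univ_empty]
  exact ZP_nonneg_of_isGraphMarkOn _ hc hdeg F T univ rfl hF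

end Sunflower

/-- **COROLLARY (the concrete family)**: for every proper 3-edge-colouring `c` of a graph of maximum degree `≤ 2` on a finite set (a disjoint
union of paths and cycles) and every choice of colour marks `T`, the sunflower `U ↦ θ(colours of edges inside U ∪ marks inside U)` has `0 ≤ ZH`.
[this work] -/
theorem ZH_graphMarkSunflower_nonneg_of_maxDegTwo (c : α → α → Option (Fin 3)) (T : α → Finset (Fin 3))
    (hc : IsProperEdgeColouring c) (hdeg : MaxDegLE c 2) : 0 ≤ (graphMarkSunflower c T).ZH :=
  Sunflower.ZH_nonneg_of_isGraphMarkOn_maxDegTwo hc hdeg (graphMarkSunflower_isGraphMarkOn c T univ)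

end Summit.CriticalPhenomena.PercolationContinuityZ3.Theorems.SunflowerPartition
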